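import Literature.AlgebraicGeometry.ComplexMultiplication.EndomorphismFieldLieAlgebraTracesReflexFieldRationalOrCM
import Literature.AlgebraicGeometry.ComplexMultiplication.EndomorphismFieldWeilClassesOfSubfield
import Literature.NumberTheory.ComplexMultiplication.CMTypeSubfieldTracesReflexFieldDegree
import HarnessLib

/-!
# The Weil classes of `k ⊆ F` are Hodge classes iff Kottwitz's reflex field `ℚ(tr(ι(a) ∣ Lie A) ∣ a ∈ k)` is `ℚ`,
# iff the `k`-signature of `Lie A` has no `Aut(ℂ)`-conjugates; otherwise that field is CM and `W_k` has only the zero Hodge class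

Topic `Literature/AlgebraicGeometry/ComplexMultiplication` (family `hodge`, lane `lit-hodgefound`; the ALGEBRAIC carrier
`Motives.AbelianVariety ℂ`, Shimura's pairs `(A, ι : F →+* A.endAlgebra)`, `[F : ℚ] = 2 dim A`, THE type `Φ = cmTypeOfPair ι hF`;
seat `lit-hodgefound-p11`, generation 29, row g29-#7).  This file JOINS two lineages of the tree on the same pair:
the Moonen–Zarhin / Deligne–Milne Weil-class criterion `EndomorphismFieldWeilClassesOfSubfield`
(`forall_isOfHodgeType_weilClassesField_iff`: `W_k ⊗ ℂ` consists of Hodge classes iff THE type is balanced over `k = ℚ(β)`)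
and Kottwitz's reflex field of the `k ⊗ ℂ`-module `Lie A` (`EndomorphismFieldLieAlgebraTracesReflexFieldRationalOrCM`, g29-#4:
`ℚ(tr(ι ∣ Lie A)|_k) = ℚ` iff `Lie A` is balanced over `k`, a CM field otherwise; `CMTypeSubfieldTracesReflexFieldDegree`, g29-#6:
its degree is the number of `Aut(ℂ)`-conjugates of the `k`-signature).  THEOREMS ONLY (D-0026): no definition, no named
fact, no instance.

THE PRINTS.  B. J. J. Moonen, Yu. G. Zarhin, *Weil classes on abelian varieties*, J. reine angew. Math. 496 (1998)
[MoonenZarhin1998WeilClasses], Introduction (held text `paper:arxiv-alg-geom_9612017` chunk p0001 L78–L97): «The dimension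
`n_σ` of `V^{1,0}_{ℂ,σ}` is called the multiplicity of `σ` on the tangent space of `X` […] **Criterion.** If `n_σ = n_{σ′}` for
all `σ ∈ Σ_F` then `W_F` consists entirely of Hodge classes; if `n_σ ≠ n_{σ′}` for some `σ ∈ Σ_F` then the zero class is the
only Hodge class in `W_F`» and (L100) «In the case of an imaginary quadratic field `F` this criterion is essentially due to
Weil».  P. Deligne (notes by J. S. Milne), LNM 900 (1982) [Deligne1982HodgeCycles] §4 Prop. 4.4 («purely of bidegree
`(d/2, d/2)` if and only if `a_σ = d/2 = b_σ`»; Milne's endnote: `(A, ν)` is of Weil type iff `Tgt₀(A)` is a free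
`E ⊗_ℚ ℂ`-module).  R. E. Kottwitz, JAMS 5 (1992) [Kottwitz1992] §5 pp. 389–390: the reflex field `E` is «the field of
definition of the isomorphism class of the complex representation `V₁` of `B`» — here `B = k`, `V₁ = Lie A`.  S. Kudla,
M. Rapoport [KudlaRapoport2013] §4.1 footnote, §4.4 («In the case where `n` is even and `r = n − r`, the reflex field is `ℚ`»;
«`E = ℚ` if `r = n − r`, and `E = k` otherwise»).  B. Dodson [Dodson1984] §3.1.1 (the conjugate signatures `f`, `ρf` over an
imaginary quadratic subfield).

WHAT IS PROVED (`ιF : F →+* A.endAlgebra`, `hF : [F : ℚ] = 2 dim A`, `β ∈ F`, `u ∈ End(A)` with `1 ⊗ u = ι(β)`, `P ∈ ℤ[T]` the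
minimal polynomial of `β` (monic, irreducible over `ℚ`, `P(β) = 0`), `deg P · r = 2 dim A`; `W := weilClassesField A u P r =
W_{ℚ(β)} ⊗ ℂ`, `E := ℚ(tr(ι(a) ∣ Lie A) ∣ a ∈ ℚ(β))`, `m` the `ℚ(β)`-signature of THE type).
§1 `natCard_galoisClass_subfieldSignature_eq_finrank_adjoin_trace_lieAction` (any `K₀ ≤ F`: `#{τ·m} = [ℚ(tr(ι ∣ Lie A)|_{K₀}) : ℚ]`
   — Kottwitz's `[E : ℚ]` = the number of conjugates of the class of `Lie A` as a `K₀ ⊗ ℂ`-module).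
§2 **`forall_isOfHodgeType_weilClassesField_iff_adjoin_trace_lieAction_eq_bot`** (`W` CONSISTS OF HODGE CLASSES ⟺ `E = ℚ`),
   `…_iff_forall_exists_trace_lieAction_eq_ratCast` (⟺ every `tr(ι(a) ∣ Lie A)`, `a ∈ ℚ(β)`, IS RATIONAL),
   `…_iff_isTotallyReal_adjoin_trace_lieAction` (⟺ `E` totally real), **`…_iff_natCard_galoisClass_subfieldSignature_eq_one`**
   (⟺ the `ℚ(β)`-signature of `Lie A` has NO conjugates), `eq_zero_of_mem_weilClassesField_of_adjoin_trace_lieAction_ne_bot`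
   (`E ≠ ℚ` ⟹ `0` is the only rational Hodge class of `W`), and for `F` CM **`isCMField_adjoin_trace_lieAction_iff_not_forall_isOfHodgeType`**
   (`E` IS A CM FIELD ⟺ `W` DOES NOT CONSIST OF HODGE CLASSES) with `eq_zero_of_mem_weilClassesField_of_isCMField_adjoin_trace_lieAction`.
§3 consequences: `forall_isOfHodgeType_weilClassesField_of_isTotallyReal` (`ℚ(β)` totally real ⟹ `W` Hodge),
   `eq_zero_of_mem_weilClassesField_of_odd` (`[F : ℚ(β)]` odd ⟹ only `0`), and for `ℚ(β)` IMAGINARY QUADRATIC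
   **`natCard_galoisClass_subfieldSignature_eq_two_iff_not_forall_isOfHodgeType`** (the signature has exactly TWO conjugates —
   `(a, n−a)` and `(n−a, a)`, Kudla–Rapoport's `E = k` — iff `W` is not made of Hodge classes).

## References

* [MoonenZarhin1998WeilClasses] B. J. J. Moonen, Yu. G. Zarhin, *Weil classes on abelian varieties*, J. reine angew. Math. 496
  (1998) 83–92 = arXiv:alg-geom/9612017, Introduction (Criterion; Remark on the imaginary quadratic case).
* [Deligne1982HodgeCycles] P. Deligne (notes by J. S. Milne), *Hodge cycles on abelian varieties*, LNM 900 (1982), §4 Prop. 4.4.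
* [Kottwitz1992] R. E. Kottwitz, *Points on some Shimura varieties over finite fields*, JAMS 5 (1992), §5 pp. 389–390.
* [KudlaRapoport2013] S. Kudla, M. Rapoport, *Special cycles on unitary Shimura varieties II*, J. reine angew. Math. 697 (2014);
  arXiv:0912.3758 §4.1 footnote, §4.4.
* [Dodson1984] B. Dodson, *The structure of Galois groups of CM-fields*, Trans. AMS 283 (1984), §3.1.1.

## Provenance

Lane `lit-hodgefound` (HOME `run/shared/lean/pub/lit-hodgefound/`), prover seat `lit-hodgefound-p11` (gen 29), self-proposed row
g29-#7 (lane INBOX claim 2026-08-27), joining g29-#4 / g29-#6 to `EndomorphismFieldWeilClassesOfSubfield`.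
-/

noncomputable section

namespace Literature.AlgebraicGeometry.ComplexMultiplication

open scoped IntermediateField Classical
open CategoryTheory NumberField Module Polynomial
open Literature.AlgebraicGeometry.Motives Literature.AlgebraicGeometry.HodgeTheory
open Literature.AlgebraicTopology.SingularHomology
open Literature.NumberTheory.ComplexMultiplication

namespace EndFieldFullDegree

variable {F : Type} [Field F] [NumberField F] {A : AbelianVariety ℂ}
  (ιF : F →+* A.endAlgebra) (hF : finrank ℚ F = 2 * A.dim)

/-! ### §0 Dictionary (private): the two spellings of the multiplicity `m_τ` -/

/-- `|{φ : φ|_k = τ, φ ∈ Φ}| = |{σ ∈ Φ : σ|_k = τ}|`. [folklore] -/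
private theorem ncard_fibre_mem_eq_card_wr (k : IntermediateField ℚ F) (τ : k →+* ℂ) :
    {φ : F →+* ℂ | φ.comp (algebraMap k F) = τ ∧ φ ∈ (cmTypeOfPair ιF hF).1}.ncard =
      Fintype.card {σ : (cmTypeOfPair ιF hF).1 // σ.1.comp (algebraMap k F) = τ} := by
  rw [← Nat.card_coe_set_eq, Fintype.card_eq_nat_card]
  exact Nat.card_congr
    { toFun := fun φ => ⟨⟨φ.1, φ.2.2⟩, φ.2.1⟩
      invFun := fun σ => ⟨σ.1.1, σ.2, σ.1.2⟩
      left_inv := fun _ => rfl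
      right_inv := fun _ => rfl }

/-- `|{φ ∈ Φ : φ|_k = τ}|` in the order of the field-level files. [folklore] -/
private theorem ncard_mem_fibre_eq_card_wr (k : IntermediateField ℚ F) (τ : k →+* ℂ) :
    {φ : F →+* ℂ | φ ∈ (cmTypeOfPair ιF hF).1 ∧ φ.comp (algebraMap k F) = τ}.ncard =
      Fintype.card {σ : (cmTypeOfPair ιF hF).1 // σ.1.comp (algebraMap k F) = τ} := by
  rw [← ncard_fibre_mem_eq_card_wr ιF hF k τ]
  congr 1
  ext φ
  exact and_comm

include hF in
/-- Balanced in Moonen–Zarhin's spelling (`n_τ = n_{τ′}`) iff balanced in Kottwitz's (`2 m_τ = [F : k]`), as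
`n_τ + n_{τ′} = [F : k]`. [folklore] -/
private theorem forall_ncard_eq_iff_forall_two_mul_card_eq_wr (k : IntermediateField ℚ F) :
    (∀ τ : k →+* ℂ, {φ : F →+* ℂ | φ.comp (algebraMap k F) = τ ∧ φ ∈ (cmTypeOfPair ιF hF).1}.ncard =
        {φ : F →+* ℂ | φ.comp (algebraMap k F) = τ ∧ φ ∉ (cmTypeOfPair ιF hF).1}.ncard) ↔
      ∀ τ : k →+* ℂ, 2 * Fintype.card {σ : (cmTypeOfPair ιF hF).1 // σ.1.comp (algebraMap k F) = τ} = finrank k F := by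
  refine forall_congr' fun τ => ?_
  have h := ncard_fibre_add_ncard_fibre_eq_finrank ιF hF k τ
  rw [← ncard_fibre_mem_eq_card_wr ιF hF k τ]
  omega

/-! ### §1 Kottwitz's degree on the pair: `#{τ·m} = [ℚ(tr(ι ∣ Lie A)|_{K₀}) : ℚ]` -/

/-- **`#{τ·m ∣ τ ∈ Aut(ℂ)} = [ℚ(tr(ι(a) ∣ Lie A) ∣ a ∈ K₀) : ℚ]`** for every subfield `K₀ ≤ F` (`m` the `K₀`-signature of THE type,
`τ·m = m ∘ τ⁻¹`): the degree of the field of definition of the isomorphism class of the `K₀ ⊗ ℂ`-module `Lie A` is the number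
of its `Aut(ℂ)`-conjugates (g29-#6 on the pair, through `ℚ(tr(ι ∣ Lie A)|_{K₀}) = ℚ(tr_Φ(K₀))`).
[cite: Kottwitz1992, §5 pp. 389–390] [cite: Deligne1982HodgeCycles, V §1 p. 216 (Milne–Shih)] -/
theorem natCard_galoisClass_subfieldSignature_eq_finrank_adjoin_trace_lieAction (K₀ : IntermediateField ℚ F) :
    Nat.card {m : (K₀ →+* ℂ) → ℕ // ∃ τ : ℂ ≃+* ℂ,
        m = fun ψ => {φ : F →+* ℂ | φ ∈ (cmTypeOfPair ιF hF).1 ∧ φ.comp (algebraMap K₀ F) = τ⁻¹ • ψ}.ncard} =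
      finrank ℚ (IntermediateField.adjoin ℚ (Set.range fun a : K₀ =>
        LinearMap.trace ℂ _ (Motives.AbelianVariety.lieAction A (ιF (algebraMap K₀ F a))))) := by
  rw [adjoin_trace_lieAction_eq_adjoin_cmTypeTrace ιF hF K₀]
  exact natCard_galoisClass_subfieldSignature_eq_finrank K₀ _

/-! ### §2 `W_k` consists of Hodge classes ⟺ `ℚ(tr(ι ∣ Lie A)|_k) = ℚ` ⟺ the `k`-signature has no conjugates -/

section Criterion

variable {β : F} {u : End A} (hu : AbelianVariety.endAlgebra.of A u = ιF β) {P : Polynomial ℤ} (hPm : P.Monic)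
  (hPirr : Irreducible (P.map (Int.castRingHom ℚ))) (hPβ : Polynomial.aeval β P = 0) {r : ℕ}
  (hr : P.natDegree * r = 2 * A.dim)

include hF hu hPm hPirr hPβ hr in
/-- **THE WEIL CLASSES OF `k = ℚ(β)` ARE HODGE CLASSES IFF KOTTWITZ'S REFLEX FIELD `ℚ(tr(ι(a) ∣ Lie A) ∣ a ∈ k)` IS `ℚ`**: both
say that `Lie A` is a free `k ⊗_ℚ ℂ`-module (`n_τ = n_{τ′}`, i.e. `2 m_τ = [F : k]`, for every `τ : k → ℂ`) — Moonen–Zarhin's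
Criterion / Deligne–Milne Prop. 4.4 on one side, Kottwitz–Kudla–Rapoport («the reflex field is `ℚ`» exactly when `r = n − r`)
on the other. [cite: MoonenZarhin1998WeilClasses, Introduction (Criterion)] [cite: Deligne1982HodgeCycles, §4 Prop. 4.4]
[cite: Kottwitz1992, §5 pp. 389–390] [cite: KudlaRapoport2013, §4.1 footnote and §4.4] -/
theorem forall_isOfHodgeType_weilClassesField_iff_adjoin_trace_lieAction_eq_bot :
    (∀ c ∈ weilClassesField A u P r, IsOfHodgeType A.dim A.X r (r / 2) (r / 2) c) ↔
      IntermediateField.adjoin ℚ (Set.range fun a : ℚ⟮β⟯ =>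
        LinearMap.trace ℂ _ (Motives.AbelianVariety.lieAction A (ιF (algebraMap ℚ⟮β⟯ F a)))) = ⊥ := by
  rw [forall_isOfHodgeType_weilClassesField_iff ιF hF hu hPm hPirr hPβ hr, adjoin_trace_lieAction_eq_bot_iff ιF hF ℚ⟮β⟯,
    forall_ncard_eq_iff_forall_two_mul_card_eq_wr ιF hF ℚ⟮β⟯]

include hF hu hPm hPirr hPβ hr in
/-- **`W_k` consists of Hodge classes iff every trace `tr(ι(a) ∣ Lie A)`, `a ∈ k`, is a rational number.**
[cite: MoonenZarhin1998WeilClasses, Introduction (Criterion)] [cite: Kottwitz1992, §5 pp. 389–390] -/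
theorem forall_isOfHodgeType_weilClassesField_iff_forall_exists_trace_lieAction_eq_ratCast :
    (∀ c ∈ weilClassesField A u P r, IsOfHodgeType A.dim A.X r (r / 2) (r / 2) c) ↔
      ∀ a : ℚ⟮β⟯, ∃ q : ℚ, LinearMap.trace ℂ _ (Motives.AbelianVariety.lieAction A (ιF (algebraMap ℚ⟮β⟯ F a))) = q := by
  rw [forall_isOfHodgeType_weilClassesField_iff_adjoin_trace_lieAction_eq_bot ιF hF hu hPm hPirr hPβ hr,
    IntermediateField.adjoin_eq_bot_iff, Set.range_subset_iff]
  refine forall_congr' fun a => ?_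
  rw [SetLike.mem_coe, IntermediateField.mem_bot, Set.mem_range]
  exact ⟨fun ⟨q, hq⟩ => ⟨q, hq.symm⟩, fun ⟨q, hq⟩ => ⟨q, hq.symm⟩⟩

include hF hu hPm hPirr hPβ hr in
/-- **`W_k` consists of Hodge classes iff `ℚ(tr(ι ∣ Lie A)|_k)` is totally real** (it is then `ℚ`).
[cite: MoonenZarhin1998WeilClasses, Introduction (Criterion)] [cite: Kottwitz1992, §5 pp. 389–390] -/
theorem forall_isOfHodgeType_weilClassesField_iff_isTotallyReal_adjoin_trace_lieAction :
    (∀ c ∈ weilClassesField A u P r, IsOfHodgeType A.dim A.X r (r / 2) (r / 2) c) ↔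
      IsTotallyReal (IntermediateField.adjoin ℚ (Set.range fun a : ℚ⟮β⟯ =>
        LinearMap.trace ℂ _ (Motives.AbelianVariety.lieAction A (ιF (algebraMap ℚ⟮β⟯ F a))))) := by
  rw [forall_isOfHodgeType_weilClassesField_iff ιF hF hu hPm hPirr hPβ hr, isTotallyReal_adjoin_trace_lieAction_iff ιF hF ℚ⟮β⟯,
    forall_ncard_eq_iff_forall_two_mul_card_eq_wr ιF hF ℚ⟮β⟯]

include hF hu hPm hPirr hPβ hr in
/-- **`W_k` CONSISTS OF HODGE CLASSES IFF THE `k`-SIGNATURE OF `Lie A` HAS NO `Aut(ℂ)`-CONJUGATES** (`#{τ·m} = 1`: the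
isomorphism class of the `k ⊗ ℂ`-module `Lie A` is defined over `ℚ`). [cite: Kottwitz1992, §5 pp. 389–390]
[cite: MoonenZarhin1998WeilClasses, Introduction (Criterion)] [cite: Dodson1984, §3.1.1 Theorem (proof, p. 12)] -/
theorem forall_isOfHodgeType_weilClassesField_iff_natCard_galoisClass_subfieldSignature_eq_one :
    (∀ c ∈ weilClassesField A u P r, IsOfHodgeType A.dim A.X r (r / 2) (r / 2) c) ↔
      Nat.card {m : (ℚ⟮β⟯ →+* ℂ) → ℕ // ∃ τ : ℂ ≃+* ℂ,
        m = fun ψ => {φ : F →+* ℂ | φ ∈ (cmTypeOfPair ιF hF).1 ∧ φ.comp (algebraMap ℚ⟮β⟯ F) = τ⁻¹ • ψ}.ncard} = 1 := by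
  rw [forall_isOfHodgeType_weilClassesField_iff_adjoin_trace_lieAction_eq_bot ιF hF hu hPm hPirr hPβ hr,
    natCard_galoisClass_subfieldSignature_eq_finrank_adjoin_trace_lieAction ιF hF ℚ⟮β⟯, IntermediateField.finrank_eq_one_iff]

include hF hu hPm hPirr hPβ hr in
/-- **`ℚ(tr(ι ∣ Lie A)|_k) ≠ ℚ` ⟹ the zero class is the only rational Hodge class of `W_k ⊗ ℂ`** (some `τ` is unbalanced;
Moonen–Zarhin's second half). [cite: MoonenZarhin1998WeilClasses, Introduction (Criterion)] [cite: Kottwitz1992, §5 pp. 389–390] -/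
theorem eq_zero_of_mem_weilClassesField_of_adjoin_trace_lieAction_ne_bot
    (hE : IntermediateField.adjoin ℚ (Set.range fun a : ℚ⟮β⟯ =>
        LinearMap.trace ℂ _ (Motives.AbelianVariety.lieAction A (ιF (algebraMap ℚ⟮β⟯ F a)))) ≠ ⊥)
    {c : complexBetti A.X r} (hc : c ∈ weilClassesField A u P r) (hcQ : IsRationalClass c)
    (hcH : IsOfHodgeType A.dim A.X r (r / 2) (r / 2) c) : c = 0 := by
  rw [Ne, ← adjoin_trace_lieAction_eq_bot_iff ιF hF ℚ⟮β⟯ |>.symm.not, ← forall_ncard_eq_iff_forall_two_mul_card_eq_wr ιF hF ℚ⟮β⟯,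
    not_forall] at hE
  obtain ⟨τ₀, hτ₀⟩ := hE
  exact eq_zero_of_mem_weilClassesField_of_not_fibres_balanced ιF hF hu hPm hPirr hPβ hr hτ₀ hc hcQ hcH

section CMField

variable [IsCMField F]

include hF hu hPm hPirr hPβ hr in
/-- **`F` CM: `ℚ(tr(ι ∣ Lie A)|_k)` IS A CM FIELD IFF `W_k` DOES NOT CONSIST OF HODGE CLASSES** (the dichotomy `ℚ` / CM of
g29-#4 against the Criterion). [cite: Kottwitz1992, §5 pp. 389–390] [cite: KudlaRapoport2013, §4.4]
[cite: MoonenZarhin1998WeilClasses, Introduction (Criterion)] -/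
theorem isCMField_adjoin_trace_lieAction_iff_not_forall_isOfHodgeType :
    IsCMField (IntermediateField.adjoin ℚ (Set.range fun a : ℚ⟮β⟯ =>
        LinearMap.trace ℂ _ (Motives.AbelianVariety.lieAction A (ιF (algebraMap ℚ⟮β⟯ F a))))) ↔
      ¬ ∀ c ∈ weilClassesField A u P r, IsOfHodgeType A.dim A.X r (r / 2) (r / 2) c := by
  rw [isCMField_adjoin_trace_lieAction_iff ιF hF ℚ⟮β⟯, forall_isOfHodgeType_weilClassesField_iff ιF hF hu hPm hPirr hPβ hr,
    forall_ncard_eq_iff_forall_two_mul_card_eq_wr ιF hF ℚ⟮β⟯, not_forall]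

include hF hu hPm hPirr hPβ hr in
/-- `F` CM, `ℚ(tr(ι ∣ Lie A)|_k)` CM ⟹ the zero class is the only rational Hodge class of `W_k ⊗ ℂ`.
[cite: MoonenZarhin1998WeilClasses, Introduction (Criterion)] [cite: Kottwitz1992, §5 pp. 389–390] -/
theorem eq_zero_of_mem_weilClassesField_of_isCMField_adjoin_trace_lieAction
    (hE : IsCMField (IntermediateField.adjoin ℚ (Set.range fun a : ℚ⟮β⟯ =>
        LinearMap.trace ℂ _ (Motives.AbelianVariety.lieAction A (ιF (algebraMap ℚ⟮β⟯ F a))))))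
    {c : complexBetti A.X r} (hc : c ∈ weilClassesField A u P r) (hcQ : IsRationalClass c)
    (hcH : IsOfHodgeType A.dim A.X r (r / 2) (r / 2) c) : c = 0 := by
  refine eq_zero_of_mem_weilClassesField_of_adjoin_trace_lieAction_ne_bot ιF hF hu hPm hPirr hPβ hr (fun hbot => ?_) hc hcQ hcH
  obtain ⟨ψ, hψ⟩ := (isCMField_adjoin_trace_lieAction_iff ιF hF ℚ⟮β⟯).1 hE
  exact hψ ((adjoin_trace_lieAction_eq_bot_iff ιF hF ℚ⟮β⟯).1 hbot ψ)

end CMField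

/-! ### §3 Consequences: totally real `k`; `[F : k]` odd; imaginary quadratic `k` -/

include hF hu hPm hPirr hPβ hr in
/-- **`k = ℚ(β)` TOTALLY REAL ⟹ `W_k` consists of Hodge classes** (every `τ` is real, `τ′ = τ`, so the Criterion's hypothesis
`n_τ = n_{τ′}` holds; equivalently `tr(ι(a) ∣ Lie A) ∈ ℚ` for `a ∈ k`). [cite: MoonenZarhin1998WeilClasses, Introduction (Criterion)]
[cite: Shimura1998, §5.2 p. 39] -/
theorem forall_isOfHodgeType_weilClassesField_of_isTotallyReal [IsTotallyReal ℚ⟮β⟯] :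
    ∀ c ∈ weilClassesField A u P r, IsOfHodgeType A.dim A.X r (r / 2) (r / 2) c :=
  (forall_isOfHodgeType_weilClassesField_iff_adjoin_trace_lieAction_eq_bot ιF hF hu hPm hPirr hPβ hr).2
    (adjoin_trace_lieAction_eq_bot_of_isTotallyReal ιF hF ℚ⟮β⟯)

include hF hu hPm hPirr hPβ hr in
/-- **`[F : ℚ(β)]` ODD ⟹ the zero class is the only rational Hodge class of `W_k ⊗ ℂ`** (`n_τ + n_{τ′}` odd, so `n_τ ≠ n_{τ′}`).
[cite: MoonenZarhin1998WeilClasses, Introduction (Criterion)] [cite: KudlaRapoport2013, §4.1 (arXiv p. 14)] -/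
theorem eq_zero_of_mem_weilClassesField_of_odd (hodd : Odd (finrank ℚ⟮β⟯ F))
    {c : complexBetti A.X r} (hc : c ∈ weilClassesField A u P r) (hcQ : IsRationalClass c)
    (hcH : IsOfHodgeType A.dim A.X r (r / 2) (r / 2) c) : c = 0 := by
  obtain ⟨τ₀⟩ : Nonempty (ℚ⟮β⟯ →+* ℂ) := inferInstance
  refine eq_zero_of_mem_weilClassesField_of_not_fibres_balanced ιF hF hu hPm hPirr hPβ hr (τ₀ := τ₀) (fun heq => ?_) hc hcQ hcH
  have h := ncard_fibre_add_ncard_fibre_eq_finrank ιF hF ℚ⟮β⟯ τ₀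
  obtain ⟨j, hj⟩ := hodd
  omega

section ImaginaryQuadratic

variable [IsTotallyComplex ℚ⟮β⟯] (h2 : finrank ℚ ℚ⟮β⟯ = 2)

include hF hu hPm hPirr hPβ hr h2 in
/-- **`k = ℚ(β)` IMAGINARY QUADRATIC: the `k`-signature of `Lie A` has exactly TWO `Aut(ℂ)`-conjugates — `(a, n−a)` and
`(n−a, a)`, `ℚ(tr(ι ∣ Lie A)|_k) = k` — iff `W_k` does NOT consist of Hodge classes** (and exactly one iff it does).
[cite: Dodson1984, §3.1.1 Theorem (proof, p. 12)] [cite: KudlaRapoport2013, §4.4] [cite: MoonenZarhin1998WeilClasses, Introduction (Criterion and Remark)] -/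
theorem natCard_galoisClass_subfieldSignature_eq_two_iff_not_forall_isOfHodgeType :
    Nat.card {m : (ℚ⟮β⟯ →+* ℂ) → ℕ // ∃ τ : ℂ ≃+* ℂ,
        m = fun ψ => {φ : F →+* ℂ | φ ∈ (cmTypeOfPair ιF hF).1 ∧ φ.comp (algebraMap ℚ⟮β⟯ F) = τ⁻¹ • ψ}.ncard} = 2 ↔
      ¬ ∀ c ∈ weilClassesField A u P r, IsOfHodgeType A.dim A.X r (r / 2) (r / 2) c := by
  rw [forall_isOfHodgeType_weilClassesField_iff_natCard_galoisClass_subfieldSignature_eq_one ιF hF hu hPm hPirr hPβ hr]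
  have hle := natCard_galoisClass_subfieldSignature_le_two ℚ⟮β⟯ (cmTypeOfPair ιF hF) h2
  have hpos : 0 < Nat.card {m : (ℚ⟮β⟯ →+* ℂ) → ℕ // ∃ τ : ℂ ≃+* ℂ,
      m = fun ψ => {φ : F →+* ℂ | φ ∈ (cmTypeOfPair ιF hF).1 ∧ φ.comp (algebraMap ℚ⟮β⟯ F) = τ⁻¹ • ψ}.ncard} := by
    haveI := finiteDimensional_adjoin_cmTypeTrace_algebraMap ℚ⟮β⟯ (cmTypeOfPair ιF hF)
    rw [natCard_galoisClass_subfieldSignature_eq_finrank]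
    exact Module.finrank_pos
  omega

end ImaginaryQuadratic

end Criterion

end EndFieldFullDegree

end Literature.AlgebraicGeometry.ComplexMultiplication
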